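import Mathlib
import HarnessLib
import Summits.ValiantsHypothesis.ValiantsHypothesis.Theses.MonotoneRestoration
import Literature.Computability.AlgebraicComplexity.ArithCircuit
import Literature.Computability.AlgebraicComplexity.ArithCircuitProofs
import Literature.Computability.AlgebraicComplexity.MonotoneStructure
import Literature.Computability.AlgebraicComplexity.PermanentIrreducible
import Literature.ModelTheory.FiniteModelTheory.CkEquiv
import Summits.ValiantsHypothesis.ValiantsHypothesis.Theorems.MonotoneRestorationMonotoneRestorationQPCosetCount
import Summits.ValiantsHypothesis.ValiantsHypothesis.Theorems.MonotoneRestorationMonotoneRestorationQPSymmetricLB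
import Summits.ValiantsHypothesis.ValiantsHypothesis.Theorems.MonotoneRestorationMonotoneRestorationQPSupportSymmetrisation
import Summits.ValiantsHypothesis.ValiantsHypothesis.Theorems.MonotoneRestorationMonotoneRestorationQPSparseRegime
import Summits.ValiantsHypothesis.ValiantsHypothesis.Theorems.MonotoneRestorationMonotoneRestorationQPBeta
import Literature.Computability.AlgebraicComplexity.SymmetricArithCircuit
import Literature.Computability.AlgebraicComplexity.DawarWilsenach2025Proofs
import Literature.GroupTheory.PermutationGroups.SmallIndexSubgroups
import Summits.ValiantsHypothesis.ValiantsHypothesis.Theorems.MonotoneRestorationQP.Negative.LoadBearing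
import Summits.ValiantsHypothesis.ValiantsHypothesis.Theorems.MonotoneRestorationMonotoneRestorationQPPermSupportCount
import Summits.ValiantsHypothesis.ValiantsHypothesis.Theorems.MonotoneRestorationMonotoneRestorationQPMulGateChildren

/-! TTRL-lite variant V19860 of stmt-ValiantsHypothesis-15886 -/

-- `Summit.ValiantsHypothesis.ValiantsHypothesis.…` is the tree's mandated single-conjunct layout
-- (Sub = Summit), so the duplicated namespace component is intended.
set_option linter.dupNamespace false

namespace Summit.ValiantsHypothesis.ValiantsHypothesis.Theorems

open Summit.ValiantsHypothesis.ValiantsHypothesis.Theses.MonotoneRestoration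
open Literature.Computability.AlgebraicComplexity

/-- TTRL-lite variant V19860 (sparsity descends to the children of a `×` gate) of
`stub_mulGate_children_extend`: over `ℝ≥0` nothing cancels, so if `P` is a nonzero `×` gate of a
labelled arithmetic circuit whose support translates (by a common monomial `μ`) into the support
of `f`, then every child `h` of `P` has at most `|supp f|` monomials. Proof: part (1) of the
landed lemma `Summit.ValiantsHypothesis.ValiantsHypothesis.Theorems.stub_mulGate_children_extend`
gives a monomial `μ'` with `supp (eval h) + μ' ⊆ supp f`, and the shift `m ↦ m + μ'` is
injective (`Finset.card_le_card_of_injOn`). [folklore] -/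
theorem stub_mulGate_children_extend_var19860 :
    ∀ (n : ℕ) (G : Type) (C : LabelledArithCircuit NNReal (Fin n × Fin n) Unit G)
      (f : MvPolynomial (Fin n × Fin n) NNReal) (P : G), C.label P = .mul → C.eval P ≠ 0 →
      (∃ μ : (Fin n × Fin n) →₀ ℕ, ∀ m ∈ (C.eval P).support, m + μ ∈ f.support) →
      ∀ h ∈ C.children P, (C.eval h).support.card ≤ f.support.card := by
  intro n G C f P hP hP0 hext h hh
  obtain ⟨μ, hμ⟩ := (stub_mulGate_children_extend C f hP hP0 hext).1 h hh
  exact Finset.card_le_card_of_injOn (fun m => m + μ) (fun m hm => hμ m hm)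
    (fun a _ b _ hab => add_right_cancel hab)

end Summit.ValiantsHypothesis.ValiantsHypothesis.Theorems
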